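import Mathlib
import Summits.NavierStokesRegularity.NavierStokesRegularity.Theorems.EulerZoomLiouvillePowerGaugeEulerLiouvilleAnchoredBudgetLocalPath
import Summits.NavierStokesRegularity.NavierStokesRegularity.Theorems.EulerZoomLiouvillePowerGaugeEulerLiouvilleAnchoredBudgetCutoffFlow
import HarnessLib

/-!
# Crux `EulerZoomLiouville.PowerGaugeEulerLiouville` (stmt-NavierStokesRegularity-19832), line `anchored-budget` REV3, stub C1 — part 3:
# ANCHORED FLOOR TRANSPORT WITHOUT A FLOW CLAUSE

Route №10 `EulerZoomLiouville` (NavierStokesRegularity), crux E.  Line `anchored-budget` (ideator ns-idea-11 g4;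
`Cruxes/PowerGaugeEulerLiouville/Lines/anchored_budget.lean`, REV3 = text of record, critic V37b 2026-08-28T11:20:22Z), stub **C1
`stub_anchoredFloorTransport`** (seat ns-sfl-p1 g4).  REV3 reads `IsAnchorablePast u p T₁ := IsClassicalEulerSolutionOn (Iio 0) 0 u p ∧ T₁ ≤ 0`
— a CLASSICAL member, NOTHING ELSE (rev0–rev2 carried a flow-owning clause «gradient bounded on compact time sets uniformly in `x`»,
under which C1 was landed as `anchoredFloorTransport`, p629380).  Here the clause is gone: on a classical far past `(−∞,T₁)` with a
stretching budget `(K, Λ)`, `K ≥ 0`, FLOOR BLOBS ARE ANCHORED — a late blob `B = B(x₀,δ) ⊆ B(0,a/2)` at time `t₀ < T₁` on which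
`|ω(t₀)| ≥ w` has at every earlier time `t₁` and for every EVICTION BUDGET `Φ` (`∫_E |u(s)| ≤ Φ(s)` for measurable `E ⊆ B(0,a)` with
`|E| ≤ |B|`) a measurable avatar `T ⊆ B(0,a)` with `|B| ≤ |T| + (∫Φ)/(a/2)` carrying the floor `|ω(t₁)|² ≥ w² e^{−2∫Λ} ((−t₀)/(−t₁))^{2K}`.

Proof (the card's rev3 device).  Labels are followed by the GLOBAL flow `X` of the CUTOFF FIELD `ψ·u` (`ψ = 1` on `B̄(0,a)`, supported in
`B(0,2a)`; part 2 `…AnchoredBudgetCutoffFlow`: uniformly Lipschitz on compact time sets with no hypothesis on `u`), whose trajectories are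
`u`-trajectories while in `B̄(0,a)`.  The RUNNING MAXIMUM `M(ξ,s) = max_{σ∈[s,t₀]} ‖X_σ ξ‖` is continuous in `(ξ,s)` (`IsCompact.continuous_sSup`),
so the STAY sets `D_s = {ξ ∈ B : M(ξ,s) < a}` and `{(ξ,s) : M(ξ,s) < a}` are measurable; on `D_s` the Jacobian of `X_s` is ONE (Liouville's
formula, `div(ψu) = div u = 0` on `B(0,a)`; part 2), so `E_s = X_s(D_s) ⊆ B(0,a)` has `|E_s| = |D_s| ≤ |B|` and
`∫_{D_s}|u(s,X_sξ)|dξ = ∫_{E_s}|u(s)| ≤ Φ(s)` — the eviction hypothesis is used ONLY at the sets `E_s`.  ESCAPE SET `Esc = {ξ ∈ B : M(ξ,t₁) ≥ a}`: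
after its last exit time an escaping label runs inside `B(0,a)` from norm `a` to norm `< a/2` through STAY times, so
`a/2 ≤ ∫_{[t₁,t₀]} 1_{D_s}(ξ)|u(s,X_sξ)|ds` (part 1 `half_le_lintegral_of_escape_curve`); Tonelli gives `(a/2)|Esc| ≤ ∫Φ`.  AVATAR
`T = X_{t₁}(B ∖ Esc) ⊆ B(0,a)`, `|T| = |B ∖ Esc|` (Jacobian one again), and the floor on `T` is part 1's `sq_norm_curl_floor_along_curve` along
the trajectories from `B ∖ Esc`, which are `u`-trajectories on `[t₁,t₀]`.

* `exists_anchored_avatar_local` — the core statement (= p629380's `exists_anchored_avatar` WITHOUT the gradient clause);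
* `anchoredFloorTransport_rev3` — **C1 = `Sig.stub_anchoredFloorTransport` (REV3) with `IsAnchorablePast`, `HasStretchingBudget`,
  `AnchoredFloorBlobs` UNFOLDED VERBATIM**.

WHAT THIS IS NOT: not NS regularity, not the crux E (19832 OPEN) — ONE line stub `--supports` stmt-19832; pure kinematics of a classical flow.
[cite: CrippaDeLellis2008, §2–3 (no-escape / compressibility estimates); MajdaBertozziCUP2002, §1.3 Prop. 1.4, §1.6 (1.51), §2.5 (2.115)–(2.117)]
-/

noncomputable section

-- flat `Theorems/<Route><Decl>…` files of one crux share the namespace of the crux (tree convention)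
set_option linter.dupNamespace false

open MeasureTheory Set Filter Topology Metric Function InnerProductSpace
open scoped RealInnerProductSpace NNReal ENNReal

namespace Summit.NavierStokesRegularity.NavierStokesRegularity.Theorems.PowerGaugeEulerLiouville.AnchoredBudget

open Literature.Analysis Literature.Analysis.FluidPDE Literature.Analysis.ODE

variable {u : ℝ → EuclideanSpace ℝ (Fin 3) → EuclideanSpace ℝ (Fin 3)} {p : ℝ → EuclideanSpace ℝ (Fin 3) → ℝ}

/-! ### The anchored avatar, without a flow clause -/

/-- **ANCHORED FLOOR TRANSPORT (core statement, REV3 — no flow clause).**  Classical Euler flow on `(−∞,0)`, a stretching budget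
`⟪∇u ω,ω⟫ ≤ (K/(−τ) + Λ)|ω|²` on `(−∞,T₁)` with `Λ` integrable there; a blob `B(x₀,δ)`, `‖x₀‖ + δ ≤ a/2`, with `|ω(t₀)| ≥ w ≥ 0` at
`t₀ < T₁ ≤ 0`; an earlier time `t₁ < t₀` and an eviction budget `Φ ≥ 0` on `[t₁,t₀]`.  Then there is a measurable `T ⊆ B(0,a)` with
`|B| ≤ |T| + (∫_{[t₁,t₀]}Φ)/(a/2)` on which `w² e^{−2∫_{(t₁,t₀)}Λ}((−t₀)/(−t₁))^{2K} ≤ |ω(t₁)|²`.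
[cite: CrippaDeLellis2008, §2–3; MajdaBertozziCUP2002, §1.3 Prop. 1.4, §1.6 (1.51), §2.5] -/
theorem exists_anchored_avatar_local (hcl : IsClassicalEulerSolutionOn (Iio 0) 0 u p) {T₁ : ℝ} (hT₁ : T₁ ≤ 0)
    {K : ℝ} {Λ : ℝ → ℝ} (hΛi : IntegrableOn Λ (Iio T₁))
    (hS : ∀ τ : ℝ, τ < T₁ → ∀ x : EuclideanSpace ℝ (Fin 3),
      ⟪fderiv ℝ (u τ) x (curl (u τ) x), curl (u τ) x⟫ ≤ (K / (-τ) + Λ τ) * ‖curl (u τ) x‖ ^ 2)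
    {t₀ : ℝ} (ht₀ : t₀ < T₁) {x₀ : EuclideanSpace ℝ (Fin 3)} {δ w a : ℝ} {Φ : ℝ → ℝ} (ha : 0 < a) (hxa : ‖x₀‖ + δ ≤ a / 2)
    (hw : ∀ x ∈ ball x₀ δ, w ≤ ‖curl (u t₀) x‖) {t₁ : ℝ} (h10 : t₁ < t₀) (hΦi : IntegrableOn Φ (Icc t₁ t₀)) (hΦ0 : ∀ s ∈ Icc t₁ t₀, 0 ≤ Φ s)
    (hΦE : ∀ s ∈ Icc t₁ t₀, ∀ E : Set (EuclideanSpace ℝ (Fin 3)), MeasurableSet E → E ⊆ ball (0 : EuclideanSpace ℝ (Fin 3)) a →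
      volume E ≤ volume (ball x₀ δ) → ∫⁻ x in E, ‖u s x‖ₑ ≤ ENNReal.ofReal (Φ s))
    (hw0 : 0 ≤ w) :
    ∃ T : Set (EuclideanSpace ℝ (Fin 3)), MeasurableSet T ∧ T ⊆ ball (0 : EuclideanSpace ℝ (Fin 3)) a ∧
      volume (ball x₀ δ) ≤ volume T + ENNReal.ofReal ((∫ s in Icc t₁ t₀, Φ s) / (a / 2)) ∧
      ∀ x ∈ T, w ^ 2 * Real.exp (-(2 * ∫ s in Ioo t₁ t₀, Λ s)) * ((-t₀) / (-t₁)) ^ (2 * K) ≤ ‖curl (u t₁) x‖ ^ 2 := by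
  have ht₀0 : t₀ < 0 := lt_of_lt_of_le ht₀ hT₁
  have ht₁0 : t₁ < 0 := h10.trans ht₀0
  have hSc : Convex ℝ (Iio (0 : ℝ)) := convex_Iio 0
  have hU : UniqueDiffOn ℝ (Iio (0 : ℝ)) := uniqueDiffOn_Iio 0
  have ht₀S : t₀ ∈ Iio (0 : ℝ) := ht₀0
  have ht₁S : t₁ ∈ Iio (0 : ℝ) := ht₁0
  have hIcc : Icc t₁ t₀ ⊆ Iio (0 : ℝ) := fun s hs => lt_of_le_of_lt hs.2 ht₀0
  have hsm : IsSmoothSpaceTimeOn (Iio 0) u := hcl.smooth_velocity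
  -- the bump `ψ`: plateau `B̄(0,a)`, support `B(0,2a)`; the cutoff flow `X` of `ψ·u` from time `t₀`
  obtain ⟨φ, hφa⟩ : ∃ φ : ContDiffBump (0 : EuclideanSpace ℝ (Fin 3)), φ.rIn = a := ⟨⟨a, 2 * a, ha, by linarith⟩, rfl⟩
  set X : ℝ → EuclideanSpace ℝ (Fin 3) → EuclideanSpace ℝ (Fin 3) :=
    ODE.evolutionMap (fun t x => (φ : EuclideanSpace ℝ (Fin 3) → ℝ) x • u t x) t₀ with hX
  have hX0 : ∀ ξ, X t₀ ξ = ξ := fun ξ => by rw [hX, ODE.evolutionMap_self]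
  set B : Set (EuclideanSpace ℝ (Fin 3)) := ball x₀ δ with hB
  have hBm : MeasurableSet B := measurableSet_ball
  have hBn : ∀ ξ ∈ B, ‖ξ‖ < a / 2 := fun ξ hξ => by
    have h1 : ‖ξ‖ ≤ ‖ξ - x₀‖ + ‖x₀‖ := norm_le_norm_sub_add ξ x₀
    have h2 : ‖ξ - x₀‖ < δ := mem_ball_iff_norm.1 hξ
    linarith
  -- joint continuity of the cutoff flow, with the time clamped to `[t₁,t₀]`
  set π : ℝ → ℝ := fun s => max t₁ (min s t₀) with hπ
  have hπc : Continuous π := continuous_const.max (continuous_id.min continuous_const)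
  have hπI : ∀ s, π s ∈ Icc t₁ t₀ := fun s => ⟨le_max_left _ _, max_le h10.le (min_le_right _ _)⟩
  have hπid : ∀ s ∈ Icc t₁ t₀, π s = s := fun s hs => by
    simp only [hπ]; rw [min_eq_left hs.2, max_eq_right hs.1]
  have hXj : ContinuousOn (fun q : ℝ × EuclideanSpace ℝ (Fin 3) => X q.1 q.2) (Iio 0 ×ˢ univ) :=
    continuousOn_cutoffFlow hsm hSc hU φ ht₀S
  have hXπ : Continuous fun q : EuclideanSpace ℝ (Fin 3) × ℝ => X (π q.2) q.1 := by
    have h2 : Continuous fun q : EuclideanSpace ℝ (Fin 3) × ℝ => ((π q.2, q.1) : ℝ × EuclideanSpace ℝ (Fin 3)) :=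
      (hπc.comp continuous_snd).prodMk continuous_fst
    exact hXj.comp_continuous h2 fun q => mk_mem_prod (hIcc (hπI q.2)) (mem_univ _)
  have huπ : Continuous fun q : EuclideanSpace ℝ (Fin 3) × ℝ => u (π q.2) (X (π q.2) q.1) := by
    have h2 : Continuous fun q : EuclideanSpace ℝ (Fin 3) × ℝ => ((π q.2, X (π q.2) q.1) : ℝ × EuclideanSpace ℝ (Fin 3)) :=
      (hπc.comp continuous_snd).prodMk hXπ
    exact hsm.continuousOn.comp_continuous h2 fun q => mk_mem_prod (hIcc (hπI q.2)) (mem_univ _)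
  -- the running maximum `M(ξ,s) = max_{σ ∈ [π s, t₀]} ‖X_σ ξ‖` (a sup over `σ = π s + θ (t₀ − π s)`, `θ ∈ [0,1]`), continuous in `(ξ,s)`
  have hρc : Continuous fun r : (EuclideanSpace ℝ (Fin 3) × ℝ) × ℝ => ‖X (π (π r.1.2 + r.2 * (t₀ - π r.1.2))) r.1.1‖ := by
    have h1 : Continuous fun r : (EuclideanSpace ℝ (Fin 3) × ℝ) × ℝ =>
        ((r.1.1, π r.1.2 + r.2 * (t₀ - π r.1.2)) : EuclideanSpace ℝ (Fin 3) × ℝ) :=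
      (continuous_fst.comp continuous_fst).prodMk
        (((hπc.comp (continuous_snd.comp continuous_fst)).add
          (continuous_snd.mul (continuous_const.sub (hπc.comp (continuous_snd.comp continuous_fst))))))
    exact (hXπ.comp h1).norm
  have hρq : ∀ q : EuclideanSpace ℝ (Fin 3) × ℝ, Continuous fun θ : ℝ => ‖X (π (π q.2 + θ * (t₀ - π q.2))) q.1‖ :=
    fun q => (hρc.comp (Continuous.prodMk_right q) :)
  set M : EuclideanSpace ℝ (Fin 3) × ℝ → ℝ := fun q =>
    sSup ((fun θ : ℝ => ‖X (π (π q.2 + θ * (t₀ - π q.2))) q.1‖) '' Icc (0 : ℝ) 1) with hM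
  have hMc : Continuous M :=
    isCompact_Icc.continuous_sSup
      (f := fun (q : EuclideanSpace ℝ (Fin 3) × ℝ) (θ : ℝ) => ‖X (π (π q.2 + θ * (t₀ - π q.2))) q.1‖) hρc
  have hKc : ∀ q : EuclideanSpace ℝ (Fin 3) × ℝ,
      IsCompact ((fun θ : ℝ => ‖X (π (π q.2 + θ * (t₀ - π q.2))) q.1‖) '' Icc (0 : ℝ) 1) :=
    fun q => isCompact_Icc.image (hρq q)
  have hKne : ∀ q : EuclideanSpace ℝ (Fin 3) × ℝ,
      ((fun θ : ℝ => ‖X (π (π q.2 + θ * (t₀ - π q.2))) q.1‖) '' Icc (0 : ℝ) 1).Nonempty :=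
    fun q => (nonempty_Icc.2 (zero_le_one : (0 : ℝ) ≤ 1)).image _
  -- `M(ξ,s) < a` iff the trajectory stays in `B(0,a)` on `[s,t₀]` (for `s ∈ [t₁,t₀]`)
  have hM_lt : ∀ ξ, ∀ s ∈ Icc t₁ t₀, M (ξ, s) < a → ∀ σ ∈ Icc s t₀, ‖X σ ξ‖ < a := by
    intro ξ s hs hlt σ hσ
    set θ : ℝ := (σ - s) / (t₀ - s) with hθ
    have hθI : θ ∈ Icc (0 : ℝ) 1 := by
      rcases eq_or_lt_of_le hs.2 with h | h
      · simp only [hθ, h, sub_self, div_zero]; exact ⟨le_rfl, zero_le_one⟩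
      · exact ⟨div_nonneg (by linarith [hσ.1]) (by linarith), div_le_one_of_le₀ (by linarith [hσ.2]) (by linarith)⟩
    have hsθ : s + θ * (t₀ - s) = σ := by
      rcases eq_or_lt_of_le hs.2 with h | h
      · have : σ = s := le_antisymm (h ▸ hσ.2) hσ.1
        rw [this, h, sub_self, mul_zero, add_zero]
      · rw [hθ, div_mul_cancel₀ _ (by linarith)]; ring
    have hσI : σ ∈ Icc t₁ t₀ := ⟨hs.1.trans hσ.1, hσ.2⟩
    have hle : ‖X (π (π s + θ * (t₀ - π s))) ξ‖ ≤ M (ξ, s) :=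
      le_csSup (hKc (ξ, s)).bddAbove (mem_image_of_mem _ hθI)
    rw [hπid s hs, hsθ, hπid σ hσI] at hle
    exact lt_of_le_of_lt hle hlt
  have hlt_M : ∀ ξ, ∀ s ∈ Icc t₁ t₀, (∀ σ ∈ Icc s t₀, ‖X σ ξ‖ < a) → M (ξ, s) < a := by
    intro ξ s hs hst
    obtain ⟨θ, hθI, hθeq⟩ := (hKc (ξ, s)).sSup_mem (hKne (ξ, s))
    have hσI : s + θ * (t₀ - s) ∈ Icc s t₀ :=
      ⟨le_add_of_nonneg_right (mul_nonneg hθI.1 (by linarith [hs.2])), by nlinarith [hθI.2, hs.2, hθI.1]⟩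
    have hσI' : s + θ * (t₀ - s) ∈ Icc t₁ t₀ := ⟨hs.1.trans hσI.1, hσI.2⟩
    have hMeq : M (ξ, s) = ‖X (π (π s + θ * (t₀ - π s))) ξ‖ := hθeq.symm
    rw [hMeq, hπid s hs, hπid _ hσI']
    exact hst _ hσI
  -- escape set and good set
  set Esc : Set (EuclideanSpace ℝ (Fin 3)) := B ∩ {ξ | a ≤ M (ξ, t₁)} with hEsc
  set G : Set (EuclideanSpace ℝ (Fin 3)) := B ∩ {ξ | M (ξ, t₁) < a} with hG
  have hMc₁ : Continuous fun ξ : EuclideanSpace ℝ (Fin 3) => M (ξ, t₁) := (hMc.comp (Continuous.prodMk_left t₁) :)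
  have hEscm : MeasurableSet Esc := hBm.inter (isClosed_le continuous_const hMc₁).measurableSet
  have hGm : MeasurableSet G := hBm.inter (isOpen_lt hMc₁ continuous_const).measurableSet
  have hBsub : B ⊆ G ∪ Esc := fun ξ hξ => by
    by_cases h : M (ξ, t₁) < a
    · exact Or.inl ⟨hξ, h⟩
    · exact Or.inr ⟨hξ, not_lt.1 h⟩
  have ht₁I : t₁ ∈ Icc t₁ t₀ := left_mem_Icc.2 h10.le
  have hGstay : ∀ ξ ∈ G, ∀ σ ∈ Icc t₁ t₀, ‖X σ ξ‖ < a := fun ξ hξ => hM_lt ξ t₁ ht₁I hξ.2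
  have hGstay' : ∀ ξ ∈ G, ∀ σ ∈ uIcc t₀ t₁, X σ ξ ∈ ball (0 : EuclideanSpace ℝ (Fin 3)) φ.rIn := fun ξ hξ σ hσ => by
    rw [uIcc_of_ge h10.le] at hσ
    rw [hφa]; exact mem_ball_zero_iff.2 (hGstay ξ hξ σ hσ)
  have hNesc : ∀ ξ, a ≤ M (ξ, t₁) → ∃ s ∈ Icc t₁ t₀, a ≤ ‖X s ξ‖ := fun ξ hξ => by
    by_contra h
    push Not at h
    exact absurd (hlt_M ξ t₁ ht₁I h) (not_lt.2 hξ)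
  -- the trajectories of the cutoff flow: velocity `ψ(X) u(s,X)`, equal to `u(s,X)` on `B̄(0,a)`
  have hγ : ∀ ξ, ∀ s ∈ Icc t₁ t₀, HasDerivAt (fun s => X s ξ)
      ((φ : EuclideanSpace ℝ (Fin 3) → ℝ) (X s ξ) • u s (X s ξ)) s := fun ξ s hs =>
    hasDerivAt_cutoffFlow hsm hSc hU φ ht₀S (isOpen_Iio.mem_nhds (hIcc hs)) ξ
  have hγc : ∀ ξ, ContinuousOn (fun s => X s ξ) (Icc t₁ t₀) := fun ξ s hs => (hγ ξ s hs).continuousAt.continuousWithinAt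
  have hvc : ∀ ξ, ContinuousOn (fun s => (φ : EuclideanSpace ℝ (Fin 3) → ℝ) (X s ξ) • u s (X s ξ)) (Icc t₁ t₀) := by
    intro ξ
    have h1 : ContinuousOn (fun s => (φ : EuclideanSpace ℝ (Fin 3) → ℝ) (X s ξ)) (Icc t₁ t₀) :=
      (φ.continuous.comp_continuousOn (hγc ξ) :)
    have h2 : ContinuousOn (fun s : ℝ => ((s, X s ξ) : ℝ × EuclideanSpace ℝ (Fin 3))) (Icc t₁ t₀) :=
      continuousOn_id.prodMk (hγc ξ)
    exact h1.smul (hsm.continuousOn.comp h2 fun s hs => mk_mem_prod (hIcc hs) (mem_univ _))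
  have hγu : ∀ ξ ∈ G, ∀ s ∈ Icc t₁ t₀, HasDerivAt (fun s => X s ξ) (u s (X s ξ)) s := fun ξ hξ s hs =>
    hasDerivAt_cutoffFlow_of_mem hsm hSc hU φ ht₀S (isOpen_Iio.mem_nhds (hIcc hs))
      (by rw [hφa]; exact mem_closedBall_zero_iff.2 (hGstay ξ hξ s hs).le)
  -- the avatar
  refine ⟨X t₁ '' G, measurableSet_image_cutoffFlow hsm hSc hU φ ht₀S ht₁S hGm, ?_, ?_, ?_⟩
  · rintro y ⟨ξ, hξ, rfl⟩
    exact mem_ball_zero_iff.2 (hGstay ξ hξ t₁ ht₁I)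
  · -- `|B| ≤ |G| + |Esc| = |T| + |Esc|` and the no-escape bound `|Esc| ≤ (∫Φ)/(a/2)`
    have hvolT : volume (X t₁ '' G) = volume G := volume_image_cutoffFlow_eq hcl hSc hU φ ht₀S ht₁S hGm hGstay'
    have hEscle : ENNReal.ofReal (a / 2) * volume Esc ≤ ENNReal.ofReal (∫ s in Icc t₁ t₀, Φ s) := by
      -- the integrand `1_{STAY}(ξ,s) |u(s, X_s ξ)|`, with clamped time (measurable on the whole product)
      set F : EuclideanSpace ℝ (Fin 3) → ℝ → ℝ≥0∞ := fun ξ s =>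
        {q : EuclideanSpace ℝ (Fin 3) × ℝ | M q < a}.indicator (fun q => ‖u (π q.2) (X (π q.2) q.1)‖ₑ) (ξ, s) with hF
      have hFm : Measurable (uncurry F) := by
        have e : uncurry F = {q : EuclideanSpace ℝ (Fin 3) × ℝ | M q < a}.indicator
            (fun q => ‖u (π q.2) (X (π q.2) q.1)‖ₑ) := by
          funext q
          rfl
        rw [e]
        exact huπ.measurable.enorm.indicator (isOpen_lt hMc continuous_const).measurableSet
      -- pointwise on `Esc`: `a/2 ≤ ∫ F ξ`
      have hpt : ∀ ξ ∈ Esc, ENNReal.ofReal (a / 2) ≤ ∫⁻ s in Icc t₁ t₀, F ξ s := by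
        intro ξ hξ
        have hξn : ‖X t₀ ξ‖ < a / 2 := by rw [hX0]; exact hBn ξ hξ.1
        have h := half_le_lintegral_of_escape_curve (hγ ξ) (hvc ξ) hξn (hNesc ξ hξ.2)
        refine h.trans (lintegral_mono_ae ((ae_restrict_iff' measurableSet_Icc).2 (Eventually.of_forall fun s hs => ?_)))
        by_cases hst : ∀ σ ∈ Icc s t₀, ‖X σ ξ‖ < a
        · have hMlt : (ξ, s) ∈ {q : EuclideanSpace ℝ (Fin 3) × ℝ | M q < a} := hlt_M ξ s hs hst
          have hin : X s ξ ∈ closedBall (0 : EuclideanSpace ℝ (Fin 3)) φ.rIn := by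
            rw [hφa]; exact mem_closedBall_zero_iff.2 (hst s ⟨le_rfl, hs.2⟩).le
          have e1 : ({s | ∀ σ ∈ Icc s t₀, ‖X σ ξ‖ < a} : Set ℝ).indicator
              (fun s => ‖(φ : EuclideanSpace ℝ (Fin 3) → ℝ) (X s ξ) • u s (X s ξ)‖ₑ) s = ‖u s (X s ξ)‖ₑ := by
            rw [indicator_of_mem (show s ∈ {s | ∀ σ ∈ Icc s t₀, ‖X σ ξ‖ < a} from hst), φ.one_of_mem_closedBall hin, one_smul]
          have e2 : F ξ s = ‖u s (X s ξ)‖ₑ := by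
            simp only [hF]
            rw [indicator_of_mem hMlt]
            simp only [hπid s hs]
          rw [e1, e2]
        · rw [indicator_of_notMem (show s ∉ {s | ∀ σ ∈ Icc s t₀, ‖X σ ξ‖ < a} from hst)]
          exact bot_le
      calc ENNReal.ofReal (a / 2) * volume Esc = ∫⁻ _ in Esc, ENNReal.ofReal (a / 2) := (setLIntegral_const _ _).symm
        _ ≤ ∫⁻ ξ in Esc, ∫⁻ s in Icc t₁ t₀, F ξ s :=
            lintegral_mono_ae ((ae_restrict_iff' hEscm).2 (Eventually.of_forall hpt))
        _ ≤ ∫⁻ ξ in B, ∫⁻ s in Icc t₁ t₀, F ξ s := lintegral_mono_set inter_subset_left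
        _ = ∫⁻ s in Icc t₁ t₀, ∫⁻ ξ in B, F ξ s := lintegral_lintegral_swap hFm.aemeasurable
        _ ≤ ∫⁻ s in Icc t₁ t₀, ENNReal.ofReal (Φ s) := by
            refine lintegral_mono_ae ((ae_restrict_iff' measurableSet_Icc).2 (Eventually.of_forall fun s hs => ?_))
            have hsS : s ∈ Iio (0 : ℝ) := hIcc hs
            -- the STAY set at time `s`
            set Ds : Set (EuclideanSpace ℝ (Fin 3)) := {ξ | M (ξ, s) < a} with hDs
            have hMcs : Continuous fun ξ : EuclideanSpace ℝ (Fin 3) => M (ξ, s) := (hMc.comp (Continuous.prodMk_left s) :)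
            have hDsm : MeasurableSet Ds := (isOpen_lt hMcs continuous_const).measurableSet
            have hDm : MeasurableSet (Ds ∩ B) := hDsm.inter hBm
            have hstayD : ∀ ξ ∈ Ds ∩ B, ∀ σ ∈ uIcc t₀ s, X σ ξ ∈ ball (0 : EuclideanSpace ℝ (Fin 3)) φ.rIn := by
              intro ξ hξ σ hσ
              rw [uIcc_of_ge hs.2] at hσ
              rw [hφa]; exact mem_ball_zero_iff.2 (hM_lt ξ s hs hξ.1 σ hσ)
            have himm : MeasurableSet (X s '' (Ds ∩ B)) := measurableSet_image_cutoffFlow hsm hSc hU φ ht₀S hsS hDm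
            have hvol : volume (X s '' (Ds ∩ B)) = volume (Ds ∩ B) := volume_image_cutoffFlow_eq hcl hSc hU φ ht₀S hsS hDm hstayD
            have hsub : X s '' (Ds ∩ B) ⊆ ball (0 : EuclideanSpace ℝ (Fin 3)) a := by
              rintro _ ⟨ξ, hξ, rfl⟩
              exact mem_ball_zero_iff.2 (hM_lt ξ s hs hξ.1 s ⟨le_rfl, hs.2⟩)
            calc ∫⁻ ξ in B, F ξ s = ∫⁻ ξ in B, Ds.indicator (fun ξ => ‖u s (X s ξ)‖ₑ) ξ := by
                  refine setLIntegral_congr_fun hBm fun ξ _ => ?_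
                  simp only [hF, hDs, indicator_apply, mem_setOf_eq, hπid s hs]
              _ = ∫⁻ ξ in Ds ∩ B, ‖u s (X s ξ)‖ₑ := by
                  rw [lintegral_indicator hDsm, Measure.restrict_restrict hDsm]
              _ = ∫⁻ y in X s '' (Ds ∩ B), ‖u s y‖ₑ :=
                  setLIntegral_comp_cutoffFlow_eq hcl hSc hU φ ht₀S hsS hDm hstayD (fun y => ‖u s y‖ₑ)
              _ ≤ ENNReal.ofReal (Φ s) :=
                  hΦE s hs _ himm hsub (hvol.le.trans (measure_mono inter_subset_right))
        _ = ENNReal.ofReal (∫ s in Icc t₁ t₀, Φ s) :=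
            (ofReal_integral_eq_lintegral_ofReal hΦi ((ae_restrict_iff' measurableSet_Icc).2 (Eventually.of_forall hΦ0))).symm
    have ha2 : 0 < a / 2 := by linarith
    have hEscle' : volume Esc ≤ ENNReal.ofReal ((∫ s in Icc t₁ t₀, Φ s) / (a / 2)) := by
      rw [ENNReal.ofReal_div_of_pos ha2, ENNReal.le_div_iff_mul_le (Or.inl ((ENNReal.ofReal_pos.2 ha2).ne'))
        (Or.inl ENNReal.ofReal_ne_top), mul_comm]
      exact hEscle
    calc volume (ball x₀ δ) = volume B := rfl
      _ ≤ volume (G ∪ Esc) := measure_mono hBsub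
      _ ≤ volume G + volume Esc := measure_union_le _ _
      _ ≤ volume (X t₁ '' G) + ENNReal.ofReal ((∫ s in Icc t₁ t₀, Φ s) / (a / 2)) := by rw [hvolT]; gcongr
  · -- the floor on the avatar: Grönwall along the `u`-trajectories from `G`
    rintro y ⟨ξ, hξ, rfl⟩
    have hfl := sq_norm_curl_floor_along_curve hcl h10 ht₀0 (hγu ξ hξ) (K := K)
      (hΛi.mono_set fun s hs => lt_of_le_of_lt hs.2 ht₀) (fun τ hτ x => hS τ (lt_of_le_of_lt hτ.2 ht₀) x)
    rw [hX0 ξ] at hfl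
    refine le_trans ?_ hfl
    have hwξ : w ^ 2 ≤ ‖curl (u t₀) ξ‖ ^ 2 := pow_le_pow_left₀ hw0 (hw ξ hξ.1) 2
    have hnn : 0 ≤ Real.exp (-(2 * ∫ s in Ioo t₁ t₀, Λ s)) * ((-t₀) / (-t₁)) ^ (2 * K) :=
      mul_nonneg (Real.exp_pos _).le (Real.rpow_nonneg (div_nonneg (by linarith) (by linarith)) _)
    calc w ^ 2 * Real.exp (-(2 * ∫ s in Ioo t₁ t₀, Λ s)) * ((-t₀) / (-t₁)) ^ (2 * K)
        = w ^ 2 * (Real.exp (-(2 * ∫ s in Ioo t₁ t₀, Λ s)) * ((-t₀) / (-t₁)) ^ (2 * K)) := by ring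
      _ ≤ ‖curl (u t₀) ξ‖ ^ 2 * (Real.exp (-(2 * ∫ s in Ioo t₁ t₀, Λ s)) * ((-t₀) / (-t₁)) ^ (2 * K)) :=
          mul_le_mul_of_nonneg_right hwξ hnn
      _ = ‖curl (u t₀) ξ‖ ^ 2 * Real.exp (-(2 * ∫ s in Ioo t₁ t₀, Λ s)) * ((-t₀) / (-t₁)) ^ (2 * K) := by ring

/-! ### C1 (REV3), verbatim -/

/-- **C1 `stub_anchoredFloorTransport` (line `anchored-budget`, REV3 text of record) — `Sig.stub_anchoredFloorTransport` with `IsAnchorablePast`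
(`:= IsClassicalEulerSolutionOn (Iio 0) 0 u p ∧ T₁ ≤ 0`, NO flow clause), `HasStretchingBudget`, `AnchoredFloorBlobs` UNFOLDED VERBATIM: on a
CLASSICAL far past with a stretching budget `(K, Λ)`, `K ≥ 0`, floor blobs are ANCHORED.**  (`exists_anchored_avatar_local`.)  Not NS regularity,
not the crux E (19832 OPEN). [cite: CrippaDeLellis2008, §2–3; MajdaBertozziCUP2002, §1.3 Prop. 1.4, §1.6 (1.51), §2.5 (2.115)–(2.117)] -/
theorem anchoredFloorTransport_rev3 :
    ∀ (u : ℝ → EuclideanSpace ℝ (Fin 3) → EuclideanSpace ℝ (Fin 3)) (p : ℝ → EuclideanSpace ℝ (Fin 3) → ℝ) (T₁ K : ℝ) (Λ : ℝ → ℝ),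
      (IsClassicalEulerSolutionOn (Set.Iio 0) 0 u p ∧ T₁ ≤ 0) →
        0 ≤ K →
          (IntegrableOn Λ (Set.Iio T₁) ∧ (∀ τ : ℝ, 0 ≤ Λ τ) ∧
              ∀ τ : ℝ, τ < T₁ → ∀ x : EuclideanSpace ℝ (Fin 3),
                ⟪fderiv ℝ (u τ) x (curl (u τ) x), curl (u τ) x⟫ ≤ (K / (-τ) + Λ τ) * ‖curl (u τ) x‖ ^ 2) →
            ∀ t₀ : ℝ, t₀ < T₁ → ∀ (x₀ : EuclideanSpace ℝ (Fin 3)) (δ w a : ℝ) (Φ : ℝ → ℝ), 0 < δ → 0 ≤ w → 0 < a → ‖x₀‖ + δ ≤ a / 2 →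
              (∀ x ∈ ball x₀ δ, w ≤ ‖curl (u t₀) x‖) →
                ∀ t₁ : ℝ, t₁ < t₀ → IntegrableOn Φ (Set.Icc t₁ t₀) → (∀ s ∈ Set.Icc t₁ t₀, 0 ≤ Φ s) →
                  (∀ s ∈ Set.Icc t₁ t₀, ∀ E : Set (EuclideanSpace ℝ (Fin 3)), MeasurableSet E →
                      E ⊆ ball (0 : EuclideanSpace ℝ (Fin 3)) a → volume E ≤ volume (ball x₀ δ) →
                        ∫⁻ x in E, ‖u s x‖ₑ ≤ ENNReal.ofReal (Φ s)) →
                    ∃ T : Set (EuclideanSpace ℝ (Fin 3)), MeasurableSet T ∧ T ⊆ ball (0 : EuclideanSpace ℝ (Fin 3)) a ∧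
                      volume (ball x₀ δ) ≤ volume T + ENNReal.ofReal ((∫ s in Set.Icc t₁ t₀, Φ s) / (a / 2)) ∧
                        ∀ x ∈ T, w ^ 2 * Real.exp (-(2 * ∫ s in Set.Ioo t₁ t₀, Λ s)) * ((-t₀) / (-t₁)) ^ (2 * K) ≤
                          ‖curl (u t₁) x‖ ^ 2 := by
  intro u p T₁ K Λ hP _hK hSB t₀ ht₀ x₀ δ w a Φ _hδ hw0 ha hxa hw t₁ h10 hΦi hΦ0 hΦE
  exact exists_anchored_avatar_local hP.1 hP.2 hSB.1 hSB.2.2 ht₀ ha hxa hw h10 hΦi hΦ0 hΦE hw0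

end Summit.NavierStokesRegularity.NavierStokesRegularity.Theorems.PowerGaugeEulerLiouville.AnchoredBudget

end
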